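import Literature.MathematicalPhysics.QuantumFieldTheory.Balaban1983to89.Node00.TwoRunSiteTransport

/-!
# NODE 00 — THE TWO-RUN SITE KEY (node U5d, option (b) made concrete WITHOUT a choice): the block-down truncation of run B's
# (2.18) index is ALWAYS admissible for run B's own history read one level up (`j ↦ g^B_{j+1}`, for which `RAgree` is `rfl`);
# forgetting admissibility embeds run A's indices and these truncations into ONE coupling-free key space; run A's keyed classes
# are its terms, run B's keyed classes are the fibres of the truncation, and the `RAgree`-truncation of option (c) factors through it

Cell `pub-ymgap`, YM-PLAN Track A (HUMAN RULING D-0062); seat `pub-ymgap-dag-n20-d` (R134 (a) N20 NE7b s3) gen 27 — continuation of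
`Node00/TwoRunSiteTransport` (gen 26, p561554).  TYPED AS DESIGN EVIDENCE for the bus OFFER «DAGN20D-G27 OFFER-KEY» (pub-ymgap INBOX,
2026-08-27); filed ONLY on dag-lead's GO (WAKE-only base).  [III] = [Balaban1988Convergent], [I] = [Balaban1987RG1].

WHY.  `Thm/BalabanUVNodesN19TargetClassWeightsE1Keyed` (B‴, p562886) and `…AtLiveRecord` (B⁗, p566249) reduced node U5d's deliverable to
N19's consumer face to TWO BARE FUNCTIONS per cutoff — key maps `kA K : SeqOfRecord …(gA K) (K₀+K) (K₀+K) → ι`,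
`kB K : SeqOfRecord …(gB K) (K₀+K+1) (K₀+K+1) → ι` into ANY index type, the class set being built in-file as
`univ.image (kA K) ∪ univ.image (kB K)`.  `TwoRunSiteTransport` typed the truncation `truncSeq` («drop run B's level-1 entry, block the others
down by L») as a function into run A's ADMISSIBLE sequences UNDER the displayed flow hypothesis `RAgree` (equality of the (2.5) cube
factors of the two histories on the window), and left the map of record open between (a) fallback class ∕ (b) coupling-free key ∕ (c) a pin
giving `RAgree`.  This file records that option (b) needs NO choice and NO flow hypothesis:
* §1 `RAgree F ν (fun j ↦ gB (j+1)) gB k` holds by `rfl` (`rAgree_shift`), so `truncSeq` at THAT pair of histories is an honest function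
  `truncShift : Seq (𝐃^B over the (K+1)-torus) (k+1) → Seq (𝐃 of the history j ↦ g^B_{j+1} over the K-torus) k` for EVERY run B — the
  block-down of an admissible run-B index is admissible on run A's lattice for run B's own history read one level up (§4 of the transport
  file is exactly this); under `RAgree` for the true pair `(gA, gB)` the classes `𝐃_j` of that shifted history ARE run A's on the window
  (`dOfRecord_shift_eq_of_rAgree`) and option (c)'s `truncSeq` has the same entries (`truncSeq_Ω_eq_truncShift_Ω`, `…_Λ_…`);
* §2 the COUPLING-FREE KEY SPACE of a torus = pairs of sequences of site sets, and the forgetful key `seqKey s = (s.Ω, s.Λ)` of ANY (2.18)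
  index: injective (`Seq.ext'`), so a keyed class of an index family along `seqKey` is ONE term (`filter_seqKey_eq`, `sum_filter_seqKey_eq`)
  and an un-hit key carries weight `0`;
* §3 the two key maps of node U5d, option (b): `twoRunKeyA := seqKey` on run A's indices, `twoRunKeyB := seqKey ∘ truncShift` on run B's;
  run A's keyed class weights are its TERM weights, run B's keyed class at a key is the sum over the FIBRE of the block-down truncation
  (`twoRunKeyB_eq_iff`) — the intended partial summation of node U5d —, option (c) factors through option (b)
  (`twoRunKeyB_eq_twoRunKeyA_truncSeq`: under `RAgree`, `kB = kA ∘ truncSeq`), and under `RAgree` every run-B class has a run-A partner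
  (`range_twoRunKeyB_subset_of_rAgree`, `image_twoRunKeyA_union_eq_of_rAgree`: the in-file class set is run A's keyed index set itself).
  Off `RAgree` the keys hit by run B and missed by run A are exactly where (a)∕(b)∕(c) differ; with (b) they are honest classes of weight
  `0` in run A — an OBLIGATION for the bad-class ∕ shell bounds (N20 ∕ N21), no longer a typing obstruction (n19-d's ANSWER-U5d (iii)).

Nothing of Bałaban's is asserted; no node count moves (typed 28∕28 · discharged 5∕28); N19 ∕ N20 ∕ N21 ∕ N27 NOT discharged; no `sorry`, no
`axiom`, no `instance`, no `notation`; one finite four-torus programme at fixed `ε` — NOT ℝ⁴, NOT OS, NOT a mass gap, NOT the Clay problem.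
-/

noncomputable section

open scoped BigOperators

namespace Literature.MathematicalPhysics.QuantumFieldTheory.Balaban1983to89.Node00

open T4Continuum B14.Eq213MaximalDomains B15Eq112TorusCover B14DomainGeom B14.Eq218Concrete

variable (F : T4Family)

/-! ## §1  The block-down truncation is admissible for run B's history read one level up — no flow hypothesis -/

/-- **`RAgree` IS `rfl` FOR THE SHIFTED HISTORY**: the pair (run A's history := `j ↦ g^B_{j+1}`, run B's history `g^B`) satisfies the
displayed coupling hypothesis of `truncSeq` on every window, by definition. [cite: Balaban1988Convergent, (2.5) p.255 (bookkeeping)] -/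
theorem rAgree_shift (ν : Stage7Numerics) (gB : ℕ → ℝ) (k : ℕ) : RAgree F ν (fun j => gB (j + 1)) gB k :=
  fun _ _ _ => rfl

/-- **THE FLOW-FREE TRUNCATION** («drop run B's level-1 entry, block the others down by L»): run B's admissible index
`(Ω₁, …, Ω_{k+1}; Λ₁, …, Λ_{k+1})` over the cutoff-`(K+1)` torus goes to the index `(Ω'_1, …, Ω'_k; Λ'_1, …, Λ'_k)`,
`Ω'_j = blockDownSet Ω_{j+1}`, `Λ'_j = blockDownSet Λ_{j+1}`, over the cutoff-`K` torus, ADMISSIBLE for the classes `𝐃_j` of run B's own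
history read one level up (`j ↦ g^B_{j+1}`): `truncSeq` at `rAgree_shift`. Defined for EVERY run B; no hypothesis on run A.
[cite: Balaban1988Convergent, (2.1) p.254, (2.18) p.257 (bookkeeping)] -/
def truncShift (ν : Stage7Numerics) {M : ℕ} (hM : 0 < M) (gB : ℕ → ℝ) {K k : ℕ}
    (s : Seq (DOfRecord F ν M gB (K + 1)) (k + 1)) : Seq (DOfRecord F ν M (fun j => gB (j + 1)) K) k :=
  truncSeq F ν hM (rAgree_shift F ν gB k) s

/-- On the window the flow-free truncation reads run B one level up: `Ω'_j = blockDownSet Ω_{j+1}`.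
[cite: Balaban1988Convergent, (2.18) p.257 (bookkeeping)] -/
theorem truncShift_Ω (ν : Stage7Numerics) {M : ℕ} (hM : 0 < M) (gB : ℕ → ℝ) {K k : ℕ}
    (s : Seq (DOfRecord F ν M gB (K + 1)) (k + 1)) {j : ℕ} (h1 : 1 ≤ j) (hj : j ≤ k) :
    (truncShift F ν hM gB s).Ω j = blockDownSet F K (s.Ω (j + 1)) :=
  truncSeq_Ω F ν hM (rAgree_shift F ν gB k) s h1 hj

/-- On the window the flow-free truncation reads run B one level up: `Λ'_j = blockDownSet Λ_{j+1}`.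
[cite: Balaban1988Convergent, (2.18) p.257 (bookkeeping)] -/
theorem truncShift_Λ (ν : Stage7Numerics) {M : ℕ} (hM : 0 < M) (gB : ℕ → ℝ) {K k : ℕ}
    (s : Seq (DOfRecord F ν M gB (K + 1)) (k + 1)) {j : ℕ} (h1 : 1 ≤ j) (hj : j ≤ k) :
    (truncShift F ν hM gB s).Λ j = blockDownSet F K (s.Λ (j + 1)) :=
  truncSeq_Λ F ν hM (rAgree_shift F ν gB k) s h1 hj

/-- Off the window the flow-free truncation is `∅` (the (2.18) normalisation). [cite: Balaban1988Convergent, (2.18) p.257 (bookkeeping)] -/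
theorem truncShift_Ω_off (ν : Stage7Numerics) {M : ℕ} (hM : 0 < M) (gB : ℕ → ℝ) {K k : ℕ}
    (s : Seq (DOfRecord F ν M gB (K + 1)) (k + 1)) {j : ℕ} (hj : ¬ (1 ≤ j ∧ j ≤ k)) :
    (truncShift F ν hM gB s).Ω j = ∅ :=
  (truncShift F ν hM gB s).Ω_off j hj

/-- **UNDER `RAgree` THE SHIFTED HISTORY'S CLASSES ARE RUN A's** on the window: `𝐃_j(g^B_{·+1}) = 𝐃_j(g^A)` over the cutoff-`K` torus,
`1 ≤ j ≤ k`. [cite: Balaban1988Convergent, (2.1) p.254, (2.5) p.255 (bookkeeping)] -/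
theorem dOfRecord_shift_eq_of_rAgree (ν : Stage7Numerics) (M : ℕ) {gA gB : ℕ → ℝ} {K k : ℕ} (hR : RAgree F ν gA gB k)
    {j : ℕ} (h1 : 1 ≤ j) (hj : j ≤ k) :
    DOfRecord F ν M (fun j => gB (j + 1)) K j = DOfRecord F ν M gA K j := by
  simp only [DOfRecord, T4Family.P_L, hR j h1 hj]

/-- **OPTION (c)'s TRUNCATION HAS THE FLOW-FREE TRUNCATION'S ENTRIES** (`Ω`): under `RAgree`, `truncSeq` into run A's admissible indices and
`truncShift` agree as sequences of site sets — they differ only in the class family indexing their codomain.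
[cite: Balaban1988Convergent, (2.18) p.257 (bookkeeping)] -/
theorem truncSeq_Ω_eq_truncShift_Ω (ν : Stage7Numerics) {M : ℕ} (hM : 0 < M) {gA gB : ℕ → ℝ} {K k : ℕ}
    (hR : RAgree F ν gA gB k) (s : Seq (DOfRecord F ν M gB (K + 1)) (k + 1)) :
    (truncSeq F ν hM hR s).Ω = (truncShift F ν hM gB s).Ω := by
  funext j
  by_cases hj : 1 ≤ j ∧ j ≤ k
  · rw [truncSeq_Ω F ν hM hR s hj.1 hj.2, truncShift_Ω F ν hM gB s hj.1 hj.2]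
  · rw [truncSeq_Ω_off F ν hM hR s hj, truncShift_Ω_off F ν hM gB s hj]

/-- **OPTION (c)'s TRUNCATION HAS THE FLOW-FREE TRUNCATION'S ENTRIES** (`Λ`). [cite: Balaban1988Convergent, (2.18) p.257 (bookkeeping)] -/
theorem truncSeq_Λ_eq_truncShift_Λ (ν : Stage7Numerics) {M : ℕ} (hM : 0 < M) {gA gB : ℕ → ℝ} {K k : ℕ}
    (hR : RAgree F ν gA gB k) (s : Seq (DOfRecord F ν M gB (K + 1)) (k + 1)) :
    (truncSeq F ν hM hR s).Λ = (truncShift F ν hM gB s).Λ := by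
  funext j
  by_cases hj : 1 ≤ j ∧ j ≤ k
  · rw [truncSeq_Λ F ν hM hR s hj.1 hj.2, truncShift_Λ F ν hM gB s hj.1 hj.2]
  · rw [(truncSeq F ν hM hR s).Λ_off j hj, (truncShift F ν hM gB s).Λ_off j hj]

/-! ## §2  The coupling-free key space of a torus and the forgetful key of a (2.18) index -/

/-- **THE COUPLING-FREE KEY SPACE** over the cutoff-`Kc` torus: pairs `({Ω_j}, {Λ_j})` of sequences of sets of finest sites, with NO
`𝐃_j`-membership and no chain clause — option (b)'s index type for node U5d («blocked site-set sequences»).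
[cite: Balaban1988Convergent, (2.18) p.257 (bookkeeping)] -/
abbrev SiteSeqKey (Kc : ℕ) : Type :=
  (ℕ → Set (Site (F.P Kc) 0)) × (ℕ → Set (Site (F.P Kc) 0))

section Key

variable {α : Type*} {D : ℕ → Set (Set α)} {k : ℕ}

/-- **THE FORGETFUL KEY** of a (2.18) index: its pair of sequences `(s.Ω, s.Λ)`, admissibility forgotten.
[cite: Balaban1988Convergent, (2.18) p.257 (bookkeeping)] -/
def seqKey (s : Seq D k) : (ℕ → Set α) × (ℕ → Set α) :=
  (s.Ω, s.Λ)

/-- The components of the forgetful key. [cite: Balaban1988Convergent, (2.18) p.257 (bookkeeping)] -/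
@[simp] theorem seqKey_fst (s : Seq D k) : (seqKey s).1 = s.Ω := rfl

/-- The components of the forgetful key. [cite: Balaban1988Convergent, (2.18) p.257 (bookkeeping)] -/
@[simp] theorem seqKey_snd (s : Seq D k) : (seqKey s).2 = s.Λ := rfl

/-- **THE FORGETFUL KEY IS INJECTIVE**: a (2.18) index is determined by its sequences (`Seq.ext'`) — forgetting admissibility identifies
nothing. [cite: Balaban1988Convergent, (2.18) p.257 (bookkeeping)] -/
theorem seqKey_injective : Function.Injective (seqKey (D := D) (k := k)) :=
  fun _ _ h => Seq.ext' (congrArg Prod.fst h) (congrArg Prod.snd h)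

/-- Two indices have the same key iff they are equal. [cite: Balaban1988Convergent, (2.18) p.257 (bookkeeping)] -/
theorem seqKey_eq_iff {s t : Seq D k} : seqKey s = seqKey t ↔ s = t :=
  seqKey_injective.eq_iff

/-- **A KEYED CLASS OF AN INDEX FAMILY ALONG THE FORGETFUL KEY IS ONE TERM**: the fibre of `seqKey` over the key of `s₀` is `{s₀}`.
[cite: Balaban1988Convergent, (2.18) p.257 (bookkeeping)] -/
theorem filter_seqKey_eq [Finite α] [DecidableEq ((ℕ → Set α) × (ℕ → Set α))] (s₀ : Seq D k) :
    Finset.univ.filter (fun s : Seq D k => seqKey s = seqKey s₀) = {s₀} := by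
  ext s
  simp only [Finset.mem_filter, Finset.mem_univ, true_and, Finset.mem_singleton, seqKey_eq_iff]

/-- … so the keyed class weight at the key of `s₀` IS the term weight of `s₀` (run A's side of node U5d under option (b)).
[cite: Balaban1988Convergent, (2.18) p.257 (bookkeeping)] -/
theorem sum_filter_seqKey_eq [Finite α] [DecidableEq ((ℕ → Set α) × (ℕ → Set α))] {β : Type*} [AddCommMonoid β]
    (f : Seq D k → β) (s₀ : Seq D k) :
    ∑ s ∈ Finset.univ.filter (fun s : Seq D k => seqKey s = seqKey s₀), f s = f s₀ := by
  rw [filter_seqKey_eq, Finset.sum_singleton]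

/-- A key hit by no index carries the keyed class weight `0`. [cite: Balaban1988Convergent, (2.18) p.257 (bookkeeping)] -/
theorem sum_filter_seqKey_eq_zero [Finite α] [DecidableEq ((ℕ → Set α) × (ℕ → Set α))] {β : Type*} [AddCommMonoid β]
    (f : Seq D k → β) {x : (ℕ → Set α) × (ℕ → Set α)} (hx : x ∉ Set.range (seqKey (D := D) (k := k))) :
    ∑ s ∈ Finset.univ.filter (fun s : Seq D k => seqKey s = x), f s = 0 := by
  refine Finset.sum_eq_zero fun s hs => ?_
  exact (hx ⟨s, (Finset.mem_filter.mp hs).2⟩).elim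

end Key

/-! ## §3  The two key maps of node U5d, option (b): run A forgets, run B truncates flow-free and forgets -/

/-- **RUN A's KEY**: forget admissibility. [cite: Balaban1988Convergent, (2.18) p.257 (bookkeeping)] -/
def twoRunKeyA (ν : Stage7Numerics) (M : ℕ) (gA : ℕ → ℝ) (K k : ℕ) (s : SeqOfRecord F ν M gA K k) : SiteSeqKey F K :=
  seqKey s

/-- **RUN B's KEY**: truncate flow-free («drop level 1, block down by L»), then forget admissibility.
[cite: Balaban1988Convergent, (2.18) p.257 (bookkeeping)] -/
def twoRunKeyB (ν : Stage7Numerics) {M : ℕ} (hM : 0 < M) (gB : ℕ → ℝ) (K k : ℕ) (s' : SeqOfRecord F ν M gB (K + 1) (k + 1)) :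
    SiteSeqKey F K :=
  seqKey (truncShift F ν hM gB s')

/-- Run A's key is injective: its keyed classes are its terms (`sum_filter_seqKey_eq`). [cite: Balaban1988Convergent, (2.18) p.257 (bookkeeping)] -/
theorem twoRunKeyA_injective (ν : Stage7Numerics) (M : ℕ) (gA : ℕ → ℝ) (K k : ℕ) :
    Function.Injective (twoRunKeyA F ν M gA K k) :=
  seqKey_injective

/-- Run A's keyed class weight at the key of `s₀` is the term weight of `s₀`. [cite: Balaban1988Convergent, (2.18) p.257 (bookkeeping)] -/
theorem sum_filter_twoRunKeyA_eq (ν : Stage7Numerics) (M : ℕ) (gA : ℕ → ℝ) (K k : ℕ) [DecidableEq (SiteSeqKey F K)]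
    {β : Type*} [AddCommMonoid β] (f : SeqOfRecord F ν M gA K k → β) (s₀ : SeqOfRecord F ν M gA K k) :
    ∑ s ∈ Finset.univ.filter (fun s => twoRunKeyA F ν M gA K k s = twoRunKeyA F ν M gA K k s₀), f s = f s₀ :=
  sum_filter_seqKey_eq f s₀

/-- Run B's key on the window, first component: `Ω'_j = blockDownSet Ω_{j+1}`. [cite: Balaban1988Convergent, (2.18) p.257 (bookkeeping)] -/
theorem twoRunKeyB_fst (ν : Stage7Numerics) {M : ℕ} (hM : 0 < M) (gB : ℕ → ℝ) (K k : ℕ)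
    (s' : SeqOfRecord F ν M gB (K + 1) (k + 1)) {j : ℕ} (h1 : 1 ≤ j) (hj : j ≤ k) :
    (twoRunKeyB F ν hM gB K k s').1 j = blockDownSet F K (s'.Ω (j + 1)) :=
  truncShift_Ω F ν hM gB s' h1 hj

/-- Run B's key on the window, second component: `Λ'_j = blockDownSet Λ_{j+1}`. [cite: Balaban1988Convergent, (2.18) p.257 (bookkeeping)] -/
theorem twoRunKeyB_snd (ν : Stage7Numerics) {M : ℕ} (hM : 0 < M) (gB : ℕ → ℝ) (K k : ℕ)
    (s' : SeqOfRecord F ν M gB (K + 1) (k + 1)) {j : ℕ} (h1 : 1 ≤ j) (hj : j ≤ k) :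
    (twoRunKeyB F ν hM gB K k s').2 j = blockDownSet F K (s'.Λ (j + 1)) :=
  truncShift_Λ F ν hM gB s' h1 hj

/-- Run B's key off the window, first component: `∅`. [cite: Balaban1988Convergent, (2.18) p.257 (bookkeeping)] -/
theorem twoRunKeyB_fst_off (ν : Stage7Numerics) {M : ℕ} (hM : 0 < M) (gB : ℕ → ℝ) (K k : ℕ)
    (s' : SeqOfRecord F ν M gB (K + 1) (k + 1)) {j : ℕ} (hj : ¬ (1 ≤ j ∧ j ≤ k)) :
    (twoRunKeyB F ν hM gB K k s').1 j = ∅ :=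
  truncShift_Ω_off F ν hM gB s' hj

/-- **RUN B's KEYED CLASSES ARE THE FIBRES OF THE BLOCK-DOWN TRUNCATION**: two run-B indices have the same key iff their flow-free
truncations coincide — the keyed class weight of run B at a key is the PARTIAL SUM of run B's (2.18) terms over the level-1 entries and the
`L`-block preimages, node U5d's intended summation «into run A's classes». [cite: Balaban1988Convergent, (2.18) p.257 (bookkeeping)] -/
theorem twoRunKeyB_eq_iff (ν : Stage7Numerics) {M : ℕ} (hM : 0 < M) (gB : ℕ → ℝ) (K k : ℕ)
    (s' s'' : SeqOfRecord F ν M gB (K + 1) (k + 1)) :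
    twoRunKeyB F ν hM gB K k s' = twoRunKeyB F ν hM gB K k s'' ↔ truncShift F ν hM gB s' = truncShift F ν hM gB s'' :=
  seqKey_eq_iff

/-- **OPTION (c) FACTORS THROUGH OPTION (b)**: under the displayed flow hypothesis `RAgree` of `truncSeq`, run B's coupling-free key is run A's
key of the `RAgree`-truncation — `kB = kA ∘ truncSeq`. [cite: Balaban1988Convergent, (2.18) p.257 (bookkeeping)] -/
theorem twoRunKeyB_eq_twoRunKeyA_truncSeq (ν : Stage7Numerics) {M : ℕ} (hM : 0 < M) {gA gB : ℕ → ℝ} {K k : ℕ}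
    (hR : RAgree F ν gA gB k) (s' : SeqOfRecord F ν M gB (K + 1) (k + 1)) :
    twoRunKeyB F ν hM gB K k s' = twoRunKeyA F ν M gA K k (truncSeq F ν hM hR s') :=
  Prod.ext (truncSeq_Ω_eq_truncShift_Ω F ν hM hR s').symm (truncSeq_Λ_eq_truncShift_Λ F ν hM hR s').symm

/-- Under `RAgree`, run B's key of `s'` equals run A's key of `s` iff the `RAgree`-truncation of `s'` is `s`: the fibre of `kB` over a run-A
key is the fibre of `truncSeq`. [cite: Balaban1988Convergent, (2.18) p.257 (bookkeeping)] -/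
theorem twoRunKeyB_eq_twoRunKeyA_iff (ν : Stage7Numerics) {M : ℕ} (hM : 0 < M) {gA gB : ℕ → ℝ} {K k : ℕ}
    (hR : RAgree F ν gA gB k) (s' : SeqOfRecord F ν M gB (K + 1) (k + 1)) (s : SeqOfRecord F ν M gA K k) :
    twoRunKeyB F ν hM gB K k s' = twoRunKeyA F ν M gA K k s ↔ truncSeq F ν hM hR s' = s := by
  rw [twoRunKeyB_eq_twoRunKeyA_truncSeq F ν hM hR s']
  exact seqKey_eq_iff

/-- **UNDER `RAgree` EVERY RUN-B CLASS HAS A RUN-A PARTNER**: the range of `kB` lies in the range of `kA`.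
[cite: Balaban1988Convergent, (2.18) p.257 (bookkeeping)] -/
theorem range_twoRunKeyB_subset_of_rAgree (ν : Stage7Numerics) {M : ℕ} (hM : 0 < M) {gA gB : ℕ → ℝ} {K k : ℕ}
    (hR : RAgree F ν gA gB k) :
    Set.range (twoRunKeyB F ν hM gB K k) ⊆ Set.range (twoRunKeyA F ν M gA K k) := by
  rintro _ ⟨s', rfl⟩
  exact ⟨truncSeq F ν hM hR s', (twoRunKeyB_eq_twoRunKeyA_truncSeq F ν hM hR s').symm⟩

/-- … hence under `RAgree` the in-file class set of B‴ ∕ B⁗, `univ.image kA ∪ univ.image kB`, is run A's keyed index set `univ.image kA`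
itself. [cite: Balaban1988Convergent, (2.18) p.257 (bookkeeping)] -/
theorem image_twoRunKeyA_union_eq_of_rAgree (ν : Stage7Numerics) {M : ℕ} (hM : 0 < M) {gA gB : ℕ → ℝ} {K k : ℕ}
    (hR : RAgree F ν gA gB k) [DecidableEq (SiteSeqKey F K)] :
    Finset.univ.image (twoRunKeyA F ν M gA K k) ∪ Finset.univ.image (twoRunKeyB F ν hM gB K k) =
      Finset.univ.image (twoRunKeyA F ν M gA K k) := by
  refine Finset.union_eq_left.mpr fun x hx => ?_
  obtain ⟨s', -, rfl⟩ := Finset.mem_image.mp hx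
  exact Finset.mem_image.mpr ⟨truncSeq F ν hM hR s', Finset.mem_univ _, (twoRunKeyB_eq_twoRunKeyA_truncSeq F ν hM hR s').symm⟩

/-- A key outside the range of run A's key carries run-A class weight `0` — off `RAgree` these are the run-B classes without a run-A partner,
an obligation for the bad-class ∕ shell weights of the K5 spine readings, not a typing obstruction.
[cite: Balaban1988Convergent, (2.18) p.257 (bookkeeping)] -/
theorem sum_filter_twoRunKeyA_eq_zero (ν : Stage7Numerics) (M : ℕ) (gA : ℕ → ℝ) (K k : ℕ) [DecidableEq (SiteSeqKey F K)]
    {β : Type*} [AddCommMonoid β] (f : SeqOfRecord F ν M gA K k → β) {x : SiteSeqKey F K}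
    (hx : x ∉ Set.range (twoRunKeyA F ν M gA K k)) :
    ∑ s ∈ Finset.univ.filter (fun s => twoRunKeyA F ν M gA K k s = x), f s = 0 :=
  sum_filter_seqKey_eq_zero f hx

end Literature.MathematicalPhysics.QuantumFieldTheory.Balaban1983to89.Node00

end
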